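import Summits.CriticalPhenomena.PercolationContinuityZ3.Theorems.PercNearOneGluingNoHeavyQuantHoeffdingMixture
import HarnessLib

/-!
# QUANT lane R8, T-DEC: HOEFFDING'S EXTREMAL PRINCIPLE — a linear functional of the Poisson-binomial law is maximised AND minimised, among
# gate vectors of the same width and gate sum, at THREE-VALUED gate vectors (prim-quant-census-2 gen 83, file 12)

builds on p205010 (kernel theorem, internal audit signed; external expert review pending)

Support file (`--supports stmt-CriticalPhenomena-4575`), QUANT lane census seat prim-quant-census-2 (gen 83); memo
`run/shared/lean/prim/quant/prim-quant-census-2-g83/HOEFFDING-G83.md`.  Theorems only, standard axioms, no sorries, no definitions.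

The corollary of the mixture theorem `blobLaw_threeValued_mixture` (`…QuantHoeffdingMixture`) in the form it is usually quoted
([cite: Hoeffding1956, Theorem 5]: the extrema of `E f(S)`, `S` the number of successes in independent trials with `Σpᵢ` fixed, are attained at
probability vectors taking at most three values, only one of them strictly between `0` and `1`).  Since `P_G = Σ λ_i P_{F_i}` with convex
weights, `Σ_h f(h) P_G(h)` is a convex combination of the numbers `Σ_h f(h) P_{F_i}(h)`, hence lies between two of them:
* **`exists_threeValued_ge`** / **`exists_threeValued_le`** — for every gate list `G ⊂ [0,1]`, every blob size `k`, every `f : ℕ → ℝ` and every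
  summation range `N`, there is a three-valued gate list `F ⊂ {0, g, 1}` (`0 < g < 1`) with `|F| = |G|`, `ΣF = ΣG`, and
  `Σ_{h<N} f h · blobLaw (G.map (k,·)) h ≤ Σ_{h<N} f h · blobLaw (F.map (k,·)) h` (resp. `≥`).
This is the tool for census laws that are LINEAR in the law (e.g. the boundary inequality `(n+2)P(0) + nP(1) ≤ n − 2` at gate sum `2` of
conjecture C, REFLECTION-G82 §3): it suffices to check them on the vectors `(1^m, g^r, 0^z)`.

HONEST STATUS.  Tool only; conjecture C, `SiblingStep`, `FarTreeRow`, `GluedLemmaW`, `GluedDominatedMass` OPEN; RATE class (log\*) / honest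
sentence of `run/shared/lean/prim/quant/README.md` unchanged.  [this work]; the statement is classical [cite: Hoeffding1956, Theorem 5] and is
proved here from `blobLaw_threeValued_mixture`, not cited.  The gluing rows served [cite: KozmaNitzan2024, Conjecture 3 (p. 15)]; product measure
[cite: Grimmett1999, §1.3 p. 10].
-/

noncomputable section

open scoped BigOperators

namespace Summit.CriticalPhenomena.PercolationContinuityZ3.Theorems
namespace Quant

open Finset

/-- the blob list of a gate list at the common blob size `k` -/
local notation3 "BL[" k ", " G "]" => LawDec.blobLaw (List.map (fun g : ℝ => ((k : ℕ), g)) G)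

namespace LawDec

/-- **HOEFFDING'S EXTREMAL PRINCIPLE (upper).**  A linear functional of the law is bounded above by its value at some three-valued gate list of
the same width and gate sum. [this work] -/
theorem exists_threeValued_ge (G : List ℝ) (hG : ∀ g ∈ G, 0 ≤ g ∧ g ≤ 1) (k N : ℕ) (f : ℕ → ℝ) :
    ∃ F : List ℝ, F.length = G.length ∧ F.sum = G.sum ∧ (∀ x ∈ F, 0 ≤ x ∧ x ≤ 1) ∧
      (∃ g : ℝ, 0 < g ∧ g < 1 ∧ ∀ x ∈ F, x = 0 ∨ x = 1 ∨ x = g) ∧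
      ∑ h ∈ Finset.range N, f h * BL[k, G] h ≤ ∑ h ∈ Finset.range N, f h * BL[k, F] h := by
  classical
  obtain ⟨ι, hι, lam, F, h0, h1, hF, hlaw⟩ := blobLaw_threeValued_mixture G hG
  -- the functional is the convex combination of its values at the `F i`
  have hmix : ∑ h ∈ Finset.range N, f h * BL[k, G] h = ∑ i, lam i * ∑ h ∈ Finset.range N, f h * BL[k, F i] h := by
    simp_rw [Finset.mul_sum]
    rw [Finset.sum_comm]
    refine Finset.sum_congr rfl fun h _ => ?_
    rw [hlaw k h, Finset.mul_sum]
    exact Finset.sum_congr rfl fun i _ => by ring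
  by_contra hcon
  have hlt : ∀ i, ∑ h ∈ Finset.range N, f h * BL[k, F i] h < ∑ h ∈ Finset.range N, f h * BL[k, G] h := by
    intro i
    by_contra hge
    exact hcon ⟨F i, (hF i).1, (hF i).2.1, (hF i).2.2.1, (hF i).2.2.2, not_lt.1 hge⟩
  obtain ⟨i₀, hi₀⟩ : ∃ i, 0 < lam i := by
    by_contra hnone
    have : ∑ i, lam i = 0 := Finset.sum_eq_zero fun i _ => le_antisymm (not_lt.1 fun h => hnone ⟨i, h⟩) (h0 i)
    rw [h1] at this; exact one_ne_zero this
  have key : ∑ i, lam i * ∑ h ∈ Finset.range N, f h * BL[k, F i] h < ∑ i, lam i * ∑ h ∈ Finset.range N, f h * BL[k, G] h :=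
    Finset.sum_lt_sum (fun i _ => mul_le_mul_of_nonneg_left (hlt i).le (h0 i))
      ⟨i₀, Finset.mem_univ _, mul_lt_mul_of_pos_left (hlt i₀) hi₀⟩
  rw [← Finset.sum_mul, h1, one_mul, ← hmix] at key
  exact lt_irrefl _ key

/-- **HOEFFDING'S EXTREMAL PRINCIPLE (lower).**  A linear functional of the law is bounded below by its value at some three-valued gate list of
the same width and gate sum. [this work] -/
theorem exists_threeValued_le (G : List ℝ) (hG : ∀ g ∈ G, 0 ≤ g ∧ g ≤ 1) (k N : ℕ) (f : ℕ → ℝ) :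
    ∃ F : List ℝ, F.length = G.length ∧ F.sum = G.sum ∧ (∀ x ∈ F, 0 ≤ x ∧ x ≤ 1) ∧
      (∃ g : ℝ, 0 < g ∧ g < 1 ∧ ∀ x ∈ F, x = 0 ∨ x = 1 ∨ x = g) ∧
      ∑ h ∈ Finset.range N, f h * BL[k, F] h ≤ ∑ h ∈ Finset.range N, f h * BL[k, G] h := by
  obtain ⟨F, h1, h2, h3, h4, h5⟩ := exists_threeValued_ge G hG k N (fun h => - f h)
  refine ⟨F, h1, h2, h3, h4, ?_⟩
  have e : ∀ L : List ℝ, ∑ h ∈ Finset.range N, (-f h) * BL[k, L] h = - ∑ h ∈ Finset.range N, f h * BL[k, L] h := fun L => by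
    rw [← Finset.sum_neg_distrib]; exact Finset.sum_congr rfl fun h _ => by ring
  rw [e, e] at h5
  linarith

end LawDec
end Quant
end Summit.CriticalPhenomena.PercolationContinuityZ3.Theorems
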